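import Summits.ValiantsHypothesis.ValiantsHypothesis.Theorems.LacunarySymmetroidMatrixDescartesDoorA26WallBubblingWeylAnatomy

/-!
# Wall bubbling for `DoorA26` — (W) fourth rung: VALUE-GENERIC ANATOMY (all Weyl-type faces at once)

HONEST FRAMING.  Rung file for obligation (W) `stub_weylFaces` of `Cruxes/DoorA26/Lines/wall_bubbling.lean` (stmt-ValiantsHypothesis-19979
`DoorA26`; OPEN, typed, never asserted), re-pointed seat val-sym-door-p1 g13 (W2).  `…WallBubblingWeylAnatomy` treated the GENERIC Weyl face (one
coincidence `δ i = δ j`).  (W) quantifies over every point of the simplex with a Weyl coincidence, including the non-generic faces `δ i = δ j ∧ δ k = δ l`,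
`δ i = δ j = δ k`, … .  This file treats them ALL AT ONCE under the single hypothesis that makes them «Weyl-type»:

  VALUE-GENERIC: every pair-sum coincidence comes from letter-value coincidences — `δ a + δ b = δ c + δ e ⟹ {δ a, δ b} = {δ c, δ e}`
  (true at all Weyl-type faces; false exactly at mixed walls `2δ_a = δ_c + δ_e` and pure-disjoint walls, which are (M)/(D) of the line).

THEOREM `valueAnatomy`: at a value-generic exponent vector, a realisable blow-up pattern (`BlockSumsZero` + `Realisable`, line definitions inlined) has,
for every realisation, every LETTER VALUE-CLASS SUM `Σ_{δ b = δ a} S b` `det`-null, the class sums pairwise `det`-orthogonal, hence all on ONE null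
ray.  Mechanism: the value class of `δ a + δ c` is `(A × C) ∪ (C × A)` for the letter classes `A, C`; its `G`-sum is `ε·det(Σ_A)` (`A = C`) or
`2ε·polar(Σ_A, Σ_C)` (`A ≠ C`) by bilinearity (`polar_sum_sum`); then the tree lemma `exists_smul_of_polar_eq_zero` (the null cone of `(Sym₂ℝ, det)`
contains no two orthogonal non-parallel vectors).  Special cases by name: NO coincidence ⇒ every letter is a class ⇒ all letters on one null ray ⇒
`G = 0` (the kernel reason why (B) needs a coincidence: `pattern_eq_zero_of_injective`); one coincidence ⇒ W2 #1; double / triple Weyl faces ⇒ the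
corresponding strata.  No new definitions; nothing here bears on `DoorA26`, `MatrixDescartes` (stmt-ValiantsHypothesis-18050) or `VP ≠ VNP`.

[folklore] Bilinearity of the polar form; elementary linear algebra of the null cone of `ℝ^{1,2}`.
-/

-- `Summit.ValiantsHypothesis.ValiantsHypothesis.…` repeats a component by the D-0017 layout
-- (single-conjunct summit), which the `dupNamespace` linter flags; the name is mandated.
set_option linter.dupNamespace false

namespace Summit.ValiantsHypothesis.ValiantsHypothesis.Theorems.LacunarySymmetroidMatrixDescartes.WallBubbling

open Finset Matrix
open scoped BigOperators

/-! ## Bilinearity of the polar form over finite sums -/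

/-- `polar(Σ_A S, T) = Σ_{a ∈ A} polar(S a, T)`. [folklore] -/
theorem polar_sum_left (A : Finset (Fin 6)) (S : Fin 6 → Matrix (Fin 2) (Fin 2) ℝ) (T : Matrix (Fin 2) (Fin 2) ℝ) :
    (((∑ a ∈ A, S a) + T).det - (∑ a ∈ A, S a).det - T.det) / 2
      = ∑ a ∈ A, (((S a + T).det - (S a).det - T.det) / 2) := by
  classical
  induction A using Finset.induction_on with
  | empty => simp
  | insert a A ha ih => rw [Finset.sum_insert ha, Finset.sum_insert ha, polar_add_left, ih]

/-- `polar(Σ_A S, Σ_B S) = Σ_{a ∈ A} Σ_{b ∈ B} polar(S a, S b)`. [folklore] -/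
theorem polar_sum_sum (A B : Finset (Fin 6)) (S : Fin 6 → Matrix (Fin 2) (Fin 2) ℝ) :
    (((∑ a ∈ A, S a) + (∑ b ∈ B, S b)).det - (∑ a ∈ A, S a).det - (∑ b ∈ B, S b).det) / 2
      = ∑ a ∈ A, ∑ b ∈ B, (((S a + S b).det - (S a).det - (S b).det) / 2) := by
  rw [polar_sum_left]
  refine Finset.sum_congr rfl fun a _ => ?_
  rw [polar_comm, polar_sum_left]
  exact Finset.sum_congr rfl fun b _ => polar_comm _ _

/-! ## The value-generic anatomy -/

/-- **VALUE-GENERIC ANATOMY** (all Weyl-type faces at once).  See the module docstring. [folklore] -/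
theorem valueAnatomy (δ : Fin 6 → ℝ)
    (hV : ∀ a b c e : Fin 6, δ a + δ b = δ c + δ e → (δ a = δ c ∧ δ b = δ e) ∨ (δ a = δ e ∧ δ b = δ c))
    (G : Matrix (Fin 6) (Fin 6) ℝ)
    (hB : ∀ v : ℝ, (∑ a, ∑ b, if δ a + δ b = v then G a b else 0) = 0)
    (ε : ℝ) (S : Fin 6 → Matrix (Fin 2) (Fin 2) ℝ) (hε : ε = 1 ∨ ε = -1) (hS : ∀ l, (S l).IsSymm)
    (hG : ∀ p q, G p q = ε * (((S p + S q).det - (S p).det - (S q).det) / 2)) :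
    (∀ a : Fin 6, (∑ b ∈ Finset.univ.filter (fun b => δ b = δ a), S b).det = 0) ∧
    (∀ a c : Fin 6,
      (((∑ b ∈ Finset.univ.filter (fun b => δ b = δ a), S b) + (∑ b ∈ Finset.univ.filter (fun b => δ b = δ c), S b)).det
        - (∑ b ∈ Finset.univ.filter (fun b => δ b = δ a), S b).det
        - (∑ b ∈ Finset.univ.filter (fun b => δ b = δ c), S b).det) / 2 = 0) ∧
    (∀ a c : Fin 6, (∑ b ∈ Finset.univ.filter (fun b => δ b = δ a), S b) ≠ 0 →
      ∃ r : ℝ, (∑ b ∈ Finset.univ.filter (fun b => δ b = δ c), S b) = r • (∑ b ∈ Finset.univ.filter (fun b => δ b = δ a), S b)) := by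
  classical
  have hε0 : ε ≠ 0 := by rcases hε with rfl | rfl <;> norm_num
  -- letter classes
  set cl : Fin 6 → Finset (Fin 6) := fun a => Finset.univ.filter (fun b => δ b = δ a) with hcl
  have mem_cl : ∀ a b, b ∈ cl a ↔ δ b = δ a := fun a b => by simp [hcl]
  -- the value class of `δ a + δ c` as a set of pairs
  have hclass : ∀ a c (p : Fin 6 × Fin 6),
      δ p.1 + δ p.2 = δ a + δ c ↔ p ∈ (cl a ×ˢ cl c) ∪ (cl c ×ˢ cl a) := by
    intro a c p
    rw [Finset.mem_union, Finset.mem_product, Finset.mem_product, mem_cl, mem_cl, mem_cl, mem_cl]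
    constructor
    · intro h
      rcases hV p.1 p.2 a c h with ⟨h1, h2⟩ | ⟨h1, h2⟩
      · exact Or.inl ⟨h1, h2⟩
      · exact Or.inr ⟨h1, h2⟩
    · rintro (⟨h1, h2⟩ | ⟨h1, h2⟩)
      · rw [h1, h2]
      · rw [h1, h2, add_comm]
  -- the class sum of the pattern over that set vanishes
  have hsum : ∀ a c, ∑ p ∈ (cl a ×ˢ cl c) ∪ (cl c ×ˢ cl a), G p.1 p.2 = 0 := by
    intro a c
    have h := hB (δ a + δ c)
    rw [blockSum_eq_sum_filter] at h
    have hset : (Finset.univ : Finset (Fin 6 × Fin 6)).filter (fun p => δ p.1 + δ p.2 = δ a + δ c)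
        = (cl a ×ˢ cl c) ∪ (cl c ×ˢ cl a) := by
      ext p; simp only [Finset.mem_filter, Finset.mem_univ, true_and]; exact hclass a c p
    rwa [hset] at h
  -- `G` summed over a product is `ε · polar` of the class sums
  have hprod : ∀ A B : Finset (Fin 6), ∑ p ∈ A ×ˢ B, G p.1 p.2
      = ε * ((((∑ a ∈ A, S a) + (∑ b ∈ B, S b)).det - (∑ a ∈ A, S a).det - (∑ b ∈ B, S b).det) / 2) := by
    intro A B
    rw [polar_sum_sum, Finset.mul_sum, Finset.sum_product]
    refine Finset.sum_congr rfl fun a _ => ?_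
    rw [Finset.mul_sum]
    exact Finset.sum_congr rfl fun b _ => hG a b
  -- (1) class sums are null
  have hnull : ∀ a, (∑ b ∈ cl a, S b).det = 0 := by
    intro a
    have h := hsum a a
    rw [Finset.union_idempotent, hprod, polar_self] at h
    rcases mul_eq_zero.mp h with h' | h'
    · exact absurd h' hε0
    · exact h'
  -- (2) class sums are pairwise orthogonal
  have horth : ∀ a c, (((∑ b ∈ cl a, S b) + (∑ b ∈ cl c, S b)).det - (∑ b ∈ cl a, S b).det - (∑ b ∈ cl c, S b).det) / 2 = 0 := by
    intro a c
    by_cases hac : δ a = δ c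
    · have hcc : cl c = cl a := by
        ext b; rw [mem_cl, mem_cl, hac]
      rw [hcc, polar_self, hnull]
    · have hdisj : Disjoint (cl a ×ˢ cl c) (cl c ×ˢ cl a) := by
        rw [Finset.disjoint_left]
        rintro ⟨x, y⟩ h1 h2
        rw [Finset.mem_product, mem_cl, mem_cl] at h1 h2
        exact hac (h1.1.symm.trans h2.1)
      have h := hsum a c
      rw [Finset.sum_union hdisj, hprod, hprod] at h
      have hsymm : (((∑ b ∈ cl c, S b) + (∑ b ∈ cl a, S b)).det - (∑ b ∈ cl c, S b).det - (∑ b ∈ cl a, S b).det) / 2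
          = (((∑ b ∈ cl a, S b) + (∑ b ∈ cl c, S b)).det - (∑ b ∈ cl a, S b).det - (∑ b ∈ cl c, S b).det) / 2 :=
        polar_comm _ _
      rw [hsymm, ← mul_add] at h
      rcases mul_eq_zero.mp h with h' | h'
      · exact absurd h' hε0
      · linarith
  refine ⟨hnull, horth, ?_⟩
  -- (3) hence parallel
  intro a c ha
  have hsa : (∑ b ∈ cl a, S b).IsSymm := by
    unfold Matrix.IsSymm; rw [Matrix.transpose_sum]; exact Finset.sum_congr rfl fun b _ => (hS b).eq
  have hsc : (∑ b ∈ cl c, S b).IsSymm := by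
    unfold Matrix.IsSymm; rw [Matrix.transpose_sum]; exact Finset.sum_congr rfl fun b _ => (hS b).eq
  have h := horth c a
  exact exists_smul_of_polar_eq_zero hsc hsa (hnull c) (hnull a) ha h

/-- Corollary: at an exponent vector with NO coincidence at all (`δ` injective and value-generic) every realisable blow-up pattern VANISHES —
the kernel form of «bubbling needs a coincidence». [folklore] -/
theorem pattern_eq_zero_of_injective (δ : Fin 6 → ℝ) (hδ : Function.Injective δ)
    (hV : ∀ a b c e : Fin 6, δ a + δ b = δ c + δ e → (δ a = δ c ∧ δ b = δ e) ∨ (δ a = δ e ∧ δ b = δ c))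
    (G : Matrix (Fin 6) (Fin 6) ℝ)
    (hB : ∀ v : ℝ, (∑ a, ∑ b, if δ a + δ b = v then G a b else 0) = 0)
    (ε : ℝ) (S : Fin 6 → Matrix (Fin 2) (Fin 2) ℝ) (hε : ε = 1 ∨ ε = -1) (hS : ∀ l, (S l).IsSymm)
    (hG : ∀ p q, G p q = ε * (((S p + S q).det - (S p).det - (S q).det) / 2)) : G = 0 := by
  classical
  obtain ⟨hnull, horth, -⟩ := valueAnatomy δ hV G hB ε S hε hS hG
  have hcl : ∀ a, Finset.univ.filter (fun b => δ b = δ a) = {a} := by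
    intro a; ext b; simp only [Finset.mem_filter, Finset.mem_univ, true_and, Finset.mem_singleton]
    exact ⟨fun h => hδ h, fun h => by rw [h]⟩
  ext p q
  have h := horth p q
  rw [hcl, hcl, Finset.sum_singleton, Finset.sum_singleton] at h
  rw [hG, h, mul_zero, Matrix.zero_apply]

end Summit.ValiantsHypothesis.ValiantsHypothesis.Theorems.LacunarySymmetroidMatrixDescartes.WallBubbling
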